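import Summits.FinalStateConjecture.FinalStateConjecture.Theorems.SwallowTheDatumUniversalWitnessFamilyStubRegionOneScriAlgebra
import Summits.FinalStateConjecture.FinalStateConjecture.Theorems.SwallowTheDatumUniversalWitnessFamilyRegionOneAnalysis
import Literature.Geometry.Lorentzian.KerrData
import Literature.Geometry.Lorentzian.GeodesicExtension
import Literature.Geometry.Lorentzian.GeodesicUniformTime
import Literature.Geometry.Lorentzian.OpensChartGeodesicODE
import Literature.Geometry.Lorentzian.LeviCivitaProofs
import HarnessLib

/-!
# Stub `stub_regionOneScri` of crux `SwallowTheDatum.UniversalWitnessFamily`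
# (stmt-FinalStateConjecture-10051, line `Sketch`), part 3/4: geodesics of the Kerr–Schild chart and
# the escape lemma

Facts about geodesics `γ` of the smooth Kerr metric `Kerr.smoothMetric M a r₀` on the chart
`Kerr.region a r₀ ⊆ E4`, read through the coordinate geodesic equations
(`OpensChart.hasDerivAt_of_isGeodesicOn`, O'Neill 1983, Ch. 3, Cor. 3.21):

* `ray_hasDerivAt_coe` — the coordinate curve has derivative the velocity;
* `ray_energy_eq` — **the Killing energy `E = −g(γ', ∂_{t*})` is conserved** (momentum form of the
  geodesic equations, `OpensChart.hasDerivAt_momentum_of_isGeodesicOn`, and stationarity `∂_{t*} g = 0`,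
  `Kerr.fderiv_bilin_basisVector_zero`; O'Neill 1983, Ch. 9, Lemma 9.26);
* `not_bddAbove_of_confined` — **the escape lemma**: a maximal geodesic whose positions and velocities
  stay bounded in the chart for `t ≥ 0` has affine domain unbounded above (uniform existence time on
  compact sets of `TM`, `exists_uniform_isGeodesicOn_of_isCompact`, and gluing, `IsGeodesicOn.piecewise`;
  O'Neill 1983, Ch. 5, Lemma 5.8; Lee 2018, Lemma 6.19);
* `exists_spatialNorm_lt` — for `a = 0`: an incomplete null ray of the exterior `{r > 2M}` is not
  bounded away from `r = 2M` on any final segment of its domain.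

References: B. O'Neill, *Semi-Riemannian geometry* (1983), Ch. 3, Cor. 3.21, Prop. 3.24; Ch. 5,
Lemma 5.8; Ch. 9, Lemma 9.26; J. M. Lee, *Introduction to Riemannian Manifolds* (2018), Lemma 6.19,
Cor. 6.20; M. Dafermos, I. Rodnianski, arXiv:0811.0354, §2.6.2, §5.1.
-/

set_option linter.dupNamespace false

noncomputable section

namespace Summit.FinalStateConjecture.FinalStateConjecture.Theorems.SwallowTheDatum.UniversalWitnessFamily

open scoped Manifold ContDiff Topology RealInnerProductSpace
open Set Function Filter Bundle Metric Literature.Geometry.Lorentzian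

/-! ## The coordinate geodesic equations in the exterior chart -/

section Ray

variable {M : ℝ}

/-- The Levi-Civita connection of the smooth Kerr metric is `C¹` (it is `C^∞`,
`isLocallyContMDiff_leviCivita_holds`). [folklore] -/
theorem contMDiffCovariantDerivative_leviCivita [Kerr.Facts] (M a r₀ : ℝ)
    [(Kerr.smoothMetric M a r₀).toPseudoRiemannianMetric.HasLeviCivita] :
    CovariantDerivative.ContMDiffCovariantDerivative
      (Kerr.smoothMetric M a r₀).toPseudoRiemannianMetric.leviCivita 1 :=
  ⟨(Kerr.smoothMetric M a r₀).toPseudoRiemannianMetric.isLocallyContMDiff_leviCivita_holds 1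
    (by rw [show ((1 : ℕ∞) : ℕ∞ω) + 1 = 2 by norm_num]; exact WithTop.coe_le_coe.2 le_top)
    univ isOpen_univ⟩

/-- **The coordinate curve of a geodesic has derivative the velocity** (O'Neill 1983, Ch. 3,
Cor. 3.21, read in the chart `Kerr.region a r₀ ⊆ E4`). [folklore] -/
theorem ray_hasDerivAt_coe [Kerr.Facts] (M a r₀ : ℝ)
    [(Kerr.smoothMetric M a r₀).toPseudoRiemannianMetric.HasLeviCivita]
    {γ : ℝ → Kerr.region a r₀} {dom : Set ℝ}
    (hγ : IsGeodesicOn (Kerr.smoothMetric M a r₀).toPseudoRiemannianMetric.leviCivita γ dom)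
    {t : ℝ} (ht : t ∈ dom) :
    HasDerivAt (fun t' ↦ (γ t' : E4)) (velocity 𝓘(ℝ, E4) γ t) t :=
  (OpensChart.hasDerivAt_of_isGeodesicOn (g := (Kerr.smoothMetric M a r₀).toPseudoRiemannianMetric)
    (G := Kerr.bilin M a) (fun _ ↦ rfl) (fun y ↦ Kerr.differentiableAt_bilin M a y) hγ ht).1

/-- **Conservation of the Killing energy** `−g(γ', ∂_{t*})` along a geodesic of the Kerr chart on an
open interval: the momentum `p₀ = g(γ', ∂_{t*})` has derivative `½ (∂_{t*} g)(γ', γ') = 0` by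
stationarity. O'Neill 1983, Ch. 9, Lemma 9.26; Wald 1984, (6.3.12). [folklore] -/
theorem ray_energy_eq [Kerr.Facts] (M a r₀ : ℝ)
    [(Kerr.smoothMetric M a r₀).toPseudoRiemannianMetric.HasLeviCivita]
    {γ : ℝ → Kerr.region a r₀} {dom : Set ℝ} (hdom : IsOpen dom) (hdc : dom.OrdConnected)
    (hγ : IsGeodesicOn (Kerr.smoothMetric M a r₀).toPseudoRiemannianMetric.leviCivita γ dom)
    {t₁ t₂ : ℝ} (ht₁ : t₁ ∈ dom) (ht₂ : t₂ ∈ dom) :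
    Kerr.bilin M a (γ t₁) (velocity 𝓘(ℝ, E4) γ t₁) (E4.basisVector 0) =
      Kerr.bilin M a (γ t₂) (velocity 𝓘(ℝ, E4) γ t₂) (E4.basisVector 0) := by
  have hd : ∀ t ∈ dom, HasDerivAt
      (fun t' ↦ Kerr.bilin M a (γ t') (velocity 𝓘(ℝ, E4) γ t') (E4.basisVector 0)) 0 t := by
    intro t ht
    have h := OpensChart.hasDerivAt_momentum_of_isGeodesicOn
      (g := (Kerr.smoothMetric M a r₀).toPseudoRiemannianMetric) (G := Kerr.bilin M a) (fun _ ↦ rfl)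
      (fun y ↦ Kerr.differentiableAt_bilin M a y) (fun y A B ↦ Kerr.bilin_symm M a y A B) hγ ht
      (E4.basisVector 0)
    rwa [Kerr.fderiv_bilin_basisVector_zero M a (Kerr.differentiableAt_bilin M a (γ t)),
      zero_apply, zero_apply, mul_zero] at h
  refine hdom.is_const_of_fderiv_eq_zero (𝕜 := ℝ) hdc.isPreconnected
    (fun t ht ↦ (hd t ht).differentiableAt.differentiableWithinAt) (fun t ht ↦ ?_) ht₁ ht₂
  have h := (hd t ht).hasFDerivAt.fderiv
  rw [h]
  ext
  simp

/-- **The areal radius along a curve**: if the coordinate curve has derivative `w` at `t` and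
`r = ‖x⃗‖ ≠ 0` there, then `t ↦ r(γ t)` has derivative `⟨x⃗, w⃗⟩/r`. [folklore] -/
theorem hasDerivAt_spatialNorm {c : ℝ → E4} {w : E4} {t : ℝ} (hc : HasDerivAt c w t)
    (h0 : E4.spatialNorm (c t) ≠ 0) :
    HasDerivAt (fun t' ↦ E4.spatialNorm (c t'))
      (⟪E4.spatial (c t), E4.spatial w⟫ / E4.spatialNorm (c t)) t := by
  have h1 : HasDerivAt (fun t' ↦ E4.spatial (c t')) (E4.spatial w) t :=
    E4.spatial.hasFDerivAt.comp_hasDerivAt t hc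
  have h2 := (h1.norm_sq).sqrt (by
    unfold E4.spatialNorm at h0
    exact pow_ne_zero 2 h0)
  have hfun : (fun t' ↦ Real.sqrt (‖E4.spatial (c t')‖ ^ 2)) = fun t' ↦ E4.spatialNorm (c t') := by
    funext t'
    rw [Real.sqrt_sq (norm_nonneg _)]
    rfl
  rw [hfun] at h2
  convert h2 using 1
  rw [Real.sqrt_sq (norm_nonneg _)]
  unfold E4.spatialNorm
  field_simp

/-! ## The escape lemma -/

/-- **Escape lemma** (O'Neill 1983, Ch. 5, Lemma 5.8; Lee 2018, Lemma 6.19 and Cor. 6.20). Let `γ` be a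
maximal geodesic of the Kerr chart `Kerr.region a r₀` on `dom ∋ 0`. If the positions `γ t`, `t ∈ dom`,
`t ≥ 0`, stay in a compact set `K` of the chart and the velocities stay bounded, then `dom` is unbounded
above: otherwise the tangent lifts lie in a compact set of `T(Kerr.region a r₀)` with a uniform existence
time `ε` (`exists_uniform_isGeodesicOn_of_isCompact`), and gluing the geodesic issuing from the tangent
lift at `b − ε/2`, `b = sup dom` (`IsGeodesicOn.piecewise`), extends `γ` beyond `b`, contradicting
maximality. [folklore] -/
theorem not_bddAbove_of_confined [Kerr.Facts] (M a r₀ : ℝ)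
    [(Kerr.smoothMetric M a r₀).toPseudoRiemannianMetric.HasLeviCivita]
    {γ : ℝ → Kerr.region a r₀} {dom : Set ℝ}
    (hmax : IsMaximalGeodesicOn (Kerr.smoothMetric M a r₀).toPseudoRiemannianMetric.leviCivita γ dom)
    (h0 : (0 : ℝ) ∈ dom) {K : Set E4} (hK : IsCompact K) (hKU : K ⊆ Kerr.region a r₀) {C : ℝ}
    (hconf : ∀ t ∈ dom, 0 ≤ t → (γ t : E4) ∈ K ∧ @Norm.norm E4 _ (velocity 𝓘(ℝ, E4) γ t) ≤ C) :
    ¬ BddAbove dom := by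
  classical
  intro hb
  haveI := contMDiffCovariantDerivative_leviCivita M a r₀
  set cov := (Kerr.smoothMetric M a r₀).toPseudoRiemannianMetric.leviCivita with hcov_def
  have hopen := hmax.isOpen
  have hoc := hmax.2.1
  set b := sSup dom with hb_def
  -- every parameter is below `b`, and `[0, b) ⊆ dom`
  have hlt : ∀ t ∈ dom, t < b := by
    intro t ht
    rcases (le_csSup hb ht).lt_or_eq with h | h
    · exact h
    · exfalso
      obtain ⟨ε, hε, hball⟩ := Metric.isOpen_iff.1 hopen t ht
      have hmem : t + ε / 2 ∈ dom := hball (by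
        rw [Metric.mem_ball, Real.dist_eq, show t + ε / 2 - t = ε / 2 by ring,
          abs_of_pos (by linarith)]
        linarith)
      have := le_csSup hb hmem
      linarith
  have hIco : ∀ t, 0 ≤ t → t < b → t ∈ dom := by
    intro t ht0 htb
    obtain ⟨t', ht', htt'⟩ := exists_lt_of_lt_csSup ⟨0, h0⟩ htb
    exact hoc.out h0 ht' ⟨ht0, htt'.le⟩
  have hb0 : 0 < b := hlt 0 h0
  -- the compact set of tangent vectors
  set e := trivializationAt E4 (TangentSpace 𝓘(ℝ, E4)) (γ 0) with he_def
  have hbase : ∀ y : Kerr.region a r₀, y ∈ e.baseSet := fun y ↦ by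
    simp [he_def, OpensChart.chartAt_source]
  set K' : Set (Kerr.region a r₀) := Subtype.val ⁻¹' K with hK'_def
  have hK' : IsCompact K' := by
    rw [Subtype.isCompact_iff, hK'_def, image_preimage_eq_of_subset (fun x hx ↦ ⟨⟨x, hKU hx⟩, rfl⟩)]
    exact hK
  set 𝒦 : Set (TangentBundle 𝓘(ℝ, E4) (Kerr.region a r₀)) :=
    (fun yw : Kerr.region a r₀ × E4 ↦
      (TotalSpace.mk' E4 yw.1 (e.symm yw.1 yw.2) : TangentBundle 𝓘(ℝ, E4) (Kerr.region a r₀))) ''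
      (K' ×ˢ closedBall (0 : E4) C) with h𝒦_def
  have h𝒦 : IsCompact 𝒦 :=
    (hK'.prod (isCompact_closedBall 0 C)).image_of_continuousOn
      (e.continuousOn_symm.mono (prod_mono (fun y _ ↦ hbase y) (subset_univ _)))
  have hmem𝒦 : ∀ t ∈ dom, 0 ≤ t → tangentLift 𝓘(ℝ, E4) γ t ∈ 𝒦 := by
    intro t ht ht0
    obtain ⟨hK1, hC1⟩ := hconf t ht ht0
    refine ⟨(γ t, velocity 𝓘(ℝ, E4) γ t), ⟨hK1, ?_⟩, ?_⟩
    · rw [mem_closedBall, dist_zero_right]; exact hC1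
    · show TotalSpace.mk' E4 (γ t) (e.symm (γ t) (velocity 𝓘(ℝ, E4) γ t)) = _
      rw [he_def, OpensChart.trivializationAt_symm_apply]
      rfl
  -- uniform existence time, and a parameter `t₁` within `ε/2` of `b`
  obtain ⟨ε, hε, huni⟩ := exists_uniform_isGeodesicOn_of_isCompact (cov := cov) h𝒦
  set t₁ := max 0 (b - ε / 2) with ht₁_def
  have ht₁0 : 0 ≤ t₁ := le_max_left _ _
  have ht₁b : t₁ < b := max_lt hb0 (by linarith)
  have ht₁ : t₁ ∈ dom := hIco t₁ ht₁0 ht₁b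
  have ht₁ε : b ≤ t₁ + ε / 2 := by
    have := le_max_right 0 (b - ε / 2); linarith
  obtain ⟨β, hβ, hβ0⟩ := huni _ (hmem𝒦 t₁ ht₁ ht₁0)
  -- translate and glue
  set V := Ioo (t₁ - ε) (t₁ + ε) with hV_def
  have hβ' : IsGeodesicOn cov (fun t ↦ β (t - t₁)) V := by
    refine (hβ.comp_sub_const t₁).mono fun t ht ↦ ?_
    simp only [mem_preimage, mem_Ioo, hV_def] at ht ⊢
    constructor <;> linarith [ht.1, ht.2]
  have ht₁V : t₁ ∈ V := ⟨by linarith, by linarith⟩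
  have hlift : tangentLift 𝓘(ℝ, E4) γ t₁ = tangentLift 𝓘(ℝ, E4) (fun t ↦ β (t - t₁)) t₁ := by
    rw [tangentLift_comp_sub_const β t₁ t₁, sub_self, hβ0]
  obtain ⟨hg, hgγ, -⟩ := hmax.isGeodesicOn.piecewise hopen isOpen_Ioo (hoc.inter ordConnected_Ioo)
    hβ' ⟨ht₁, ht₁V⟩ hlift
  have hoc' : (dom ∪ V).OrdConnected :=
    (IsPreconnected.union t₁ ht₁ ht₁V hoc.isPreconnected isPreconnected_Ioo).ordConnected
  have heq : dom ∪ V = dom :=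
    hmax.2.2.2 _ (dom ∪ V) (hopen.union isOpen_Ioo) hoc' subset_union_left hg
      fun t ht ↦ (hgγ ht).symm
  have hmem : t₁ + ε / 2 ∈ dom := by
    rw [← heq]; exact Or.inr ⟨by linarith, by linarith⟩
  have := hlt _ hmem
  linarith

/-- **An incomplete null ray of the exterior approaches the horizon.** Let `γ` be a maximal geodesic of
the Schwarzschild exterior `(Kerr.region 0 (2M), g_{M,0})` on `dom ∋ 0` with conserved Killing energy
`g(γ', ∂_{t*}) = −E` and null velocity. If `dom` is bounded above then `r ∘ γ` is not bounded away from
`2M` on any final segment: for every `T ∈ dom`, `T ≥ 0`, and `δ > 0` there is `t ≥ T` in `dom` with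
`r(γ t) < 2M + δ`. Indeed on `{r ≥ 2M + δ}` the null cone bounds `‖γ'‖` in terms of `E`
(`norm_sq_le_of_null`), so positions and velocities would stay in a compact set of the chart, which the
escape lemma forbids. Dafermos–Rodnianski arXiv:0811.0354, §2.6.2; O'Neill 1983, Ch. 5, Lemma 5.8.
[folklore] -/
theorem exists_spatialNorm_lt [Kerr.Facts] (hM : 0 < M)
    [(Kerr.smoothMetric M 0 (Kerr.rPlus M 0)).toPseudoRiemannianMetric.HasLeviCivita]
    {γ : ℝ → Kerr.region 0 (Kerr.rPlus M 0)} {dom : Set ℝ}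
    (hmax : IsMaximalGeodesicOn
      (Kerr.smoothMetric M 0 (Kerr.rPlus M 0)).toPseudoRiemannianMetric.leviCivita γ dom)
    (h0 : (0 : ℝ) ∈ dom) {E : ℝ}
    (hE : ∀ t ∈ dom, Kerr.bilin M 0 (γ t) (velocity 𝓘(ℝ, E4) γ t) (E4.basisVector 0) = -E)
    (hnull : ∀ t ∈ dom,
      Kerr.bilin M 0 (γ t) (velocity 𝓘(ℝ, E4) γ t) (velocity 𝓘(ℝ, E4) γ t) = 0)
    (hb : BddAbove dom) {T : ℝ} (hT : T ∈ dom) (hT0 : 0 ≤ T) {δ : ℝ} (hδ : 0 < δ) :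
    ∃ t ∈ dom, T ≤ t ∧ E4.spatialNorm (γ t : E4) < 2 * M + δ := by
  by_contra H
  push Not at H
  have hoc := hmax.2.1
  set ρ : ℝ → ℝ := fun t ↦ E4.spatialNorm (γ t : E4) with hρ_def
  have hρM : ∀ t, 2 * M < ρ t := fun t ↦ two_mul_lt_spatialNorm hM.le (γ t)
  -- derivatives of the coordinates and of `r`
  have hder : ∀ t ∈ dom, HasDerivAt (fun t' ↦ (γ t' : E4)) (velocity 𝓘(ℝ, E4) γ t) t :=
    fun t ht ↦ ray_hasDerivAt_coe M 0 _ hmax.isGeodesicOn ht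
  have hρd : ∀ t ∈ dom, HasDerivAt ρ
      (⟪E4.spatial (γ t : E4), E4.spatial (velocity 𝓘(ℝ, E4) γ t)⟫ / ρ t) t :=
    fun t ht ↦ hasDerivAt_spatialNorm (hder t ht) (by linarith [hρM t] : ρ t ≠ 0)
  -- a uniform lower bound `2M + δ₂ ≤ r` on `dom ∩ [0, ∞)`
  have hcont : ContinuousOn ρ (Icc 0 T) := fun t ht ↦
    (hρd t (hoc.out h0 hT ht)).continuousAt.continuousWithinAt
  obtain ⟨tm, -, hmin⟩ := isCompact_Icc.exists_isMinOn (nonempty_Icc.2 hT0) hcont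
  set δ₂ := min δ (ρ tm - 2 * M) with hδ₂_def
  have hδ₂ : 0 < δ₂ := lt_min hδ (by linarith [hρM tm])
  have hlow : ∀ t ∈ dom, 0 ≤ t → 2 * M + δ₂ ≤ ρ t := by
    intro t ht ht0
    rcases le_total t T with htT | hTt
    · have h1 : ρ tm ≤ ρ t := hmin ⟨ht0, htT⟩
      have h2 : δ₂ ≤ ρ tm - 2 * M := min_le_right _ _
      linarith
    · have h1 := H t ht hTt
      have h2 : δ₂ ≤ δ := min_le_left _ _
      linarith
  -- the velocity bound away from the horizon
  set f₀ := 1 - 2 * M / (2 * M + δ₂) with hf₀_def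
  have hf₀ : 0 < f₀ := by
    rw [hf₀_def, sub_pos, div_lt_one (by linarith)]; linarith
  set Cv := Real.sqrt ((((2 / f₀ + 1) ^ 2 + (1 / f₀ + 1))) * E ^ 2) with hCv_def
  have hvel : ∀ t ∈ dom, 0 ≤ t → @Norm.norm E4 _ (velocity 𝓘(ℝ, E4) γ t) ≤ Cv := by
    intro t ht ht0
    have hx : 2 * M < E4.spatialNorm (γ t : E4) := hρM t
    have hxf : f₀ ≤ 1 - 2 * M / E4.spatialNorm (γ t : E4) := by
      have h1 := hlow t ht ht0
      have h2 : 2 * M / E4.spatialNorm (γ t : E4) ≤ 2 * M / (2 * M + δ₂) :=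
        div_le_div_of_nonneg_left (by linarith) (by linarith) h1
      rw [hf₀_def]; linarith
    have h := norm_sq_le_of_null hM.le hf₀ hxf hx (hnull t ht)
    rw [hE t ht, neg_sq] at h
    exact (le_abs_self _).trans (Real.abs_le_sqrt h)
  have hCv0 : 0 ≤ Cv := Real.sqrt_nonneg _
  -- the position bound
  obtain ⟨B, hB⟩ := hb
  have hpos : ∀ t ∈ dom, 0 ≤ t → ‖(γ t : E4) - (γ 0 : E4)‖ ≤ Cv * B := by
    intro t ht ht0
    have hsub : Icc 0 t ⊆ dom := hoc.out h0 ht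
    have h := (convex_Icc 0 t).norm_image_sub_le_of_norm_hasDerivWithin_le
      (f := fun t' ↦ (γ t' : E4)) (fun x hx ↦ (hder x (hsub hx)).hasDerivWithinAt)
      (fun x hx ↦ hvel x (hsub hx) hx.1) (left_mem_Icc.2 ht0) (right_mem_Icc.2 ht0)
    rw [sub_zero, Real.norm_eq_abs, abs_of_nonneg ht0] at h
    exact h.trans (mul_le_mul_of_nonneg_left (hB ht) hCv0)
  -- confinement to a compact set of the chart
  set K : Set E4 := closedBall (γ 0 : E4) (Cv * B) ∩ {x | 2 * M + δ₂ ≤ E4.spatialNorm x} with hK_def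
  have hK : IsCompact K := (isCompact_closedBall _ _).inter_right
    (isClosed_le continuous_const (continuous_norm.comp E4.spatial.continuous))
  have hKU : K ⊆ Kerr.region 0 (Kerr.rPlus M 0) := by
    intro x hx
    rw [SetLike.mem_coe, Kerr.mem_region, Kerr.radius_zero_left, Kerr.rPlus_zero_right hM.le,
      max_eq_left (by linarith)]
    have := hx.2
    simp only [mem_setOf_eq] at this
    linarith
  refine not_bddAbove_of_confined M 0 _ hmax h0 hK hKU (C := Cv)
    (fun t ht ht0 ↦ ⟨⟨?_, ?_⟩, ?_⟩) ⟨B, hB⟩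
  · rw [mem_closedBall, dist_eq_norm]; exact hpos t ht ht0
  · exact hlow t ht ht0
  · exact hvel t ht ht0

/-- **Anchor of part 3** (registered sub-goal `regionOneScri_horizonApproach` of stub
`stub_regionOneScri`): an incomplete null ray of the exterior is not bounded away from `r = 2M`
(`exists_spatialNorm_lt`). Dafermos–Rodnianski arXiv:0811.0354, §2.6.2. -/
theorem regionOneScri_horizonApproach :
    ∀ [Kerr.Facts] (M : ℝ), 0 < M → ∀ [(Kerr.smoothMetric M 0 (Kerr.rPlus M
      0)).toPseudoRiemannianMetric.HasLeviCivita] (γ : ℝ → Kerr.region 0 (Kerr.rPlus M 0)) (dom :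
      Set ℝ), IsMaximalGeodesicOn (Kerr.smoothMetric M 0 (Kerr.rPlus M
      0)).toPseudoRiemannianMetric.leviCivita γ dom → (0 : ℝ) ∈ dom → ∀ E : ℝ, (∀ t ∈ dom,
      Kerr.bilin M 0 (γ t) (velocity 𝓘(ℝ, E4) γ t) (E4.basisVector 0) = -E) → (∀ t ∈ dom, Kerr.bilin
      M 0 (γ t) (velocity 𝓘(ℝ, E4) γ t) (velocity 𝓘(ℝ, E4) γ t) = 0) → BddAbove dom → ∀ T ∈ dom, 0 ≤
      T → ∀ δ : ℝ, 0 < δ → ∃ t ∈ dom, T ≤ t ∧ E4.spatialNorm (γ t : E4) < 2 * M + δ :=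
  fun _ hM _ _ _ hmax h0 _ hE hnull hb _ hT hT0 _ hδ ↦
    exists_spatialNorm_lt hM hmax h0 hE hnull hb hT hT0 hδ

end Ray

end Summit.FinalStateConjecture.FinalStateConjecture.Theorems.SwallowTheDatum.UniversalWitnessFamily

end
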